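import Literature.Analysis.Distribution.Hypoelliptic
import Mathlib.Geometry.Manifold.PartitionOfUnity
import HarnessLib

/-!
# Smoothness of a distribution is a local property; hypoellipticity is a local property

Analysis/Distribution support file for the decomposition of the named fact
`Literature.Analysis.Distribution.Hormander1967_thm11` (Hörmander's hypoellipticity theorem,
`Literature/Analysis/Distribution/Hypoelliptic.lean`). Hörmander's proof of Theorem 1.1
(Acta Math. 119 (1967), §3) is local: the a priori estimate (3.4) is proved on open sets where
finitely many brackets span (Theorem 4.3 assumes `T^s(Ω) = T(Ω)`), and Proposition 3.2
concludes "The same is true for open subsets of `Ω`, so in particular `P` is hypoelliptic".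
Assembling the theorem on an arbitrary open `Ω` from such local statements uses two folklore
facts which this file PROVES for the notions of `Hypoelliptic.lean`:

* `Literature.Analysis.Distribution.IsSmoothOn.of_locally` — **being a `C^∞` function is a local
  property of a distribution**: if every point of the open set `U ⊆ Ω` has an open
  neighbourhood `V ⊆ U` with `u|_V ∈ C^∞(V)`, then `u|_U ∈ C^∞(U)`. Proof: the local densities
  agree on overlaps (fundamental lemma of the calculus of variations,
  `IsOpen.ae_eq_zero_of_integral_contDiff_smul_eq_zero`, plus continuity and positivity of the
  reference measure on open sets), so they glue to one function `G`, smooth on `U`; for a test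
  function `φ` supported in `U` a smooth partition of unity on `tsupport φ` subordinate to the
  cover (`SmoothPartitionOfUnity.exists_isSubordinate`) splits `φ` into finitely many test
  functions supported in single pieces, on each of which `⟨u, ·⟩ = ∫ G ·`.
* `Literature.Analysis.Distribution.restrictOpens` — the restriction `𝓓'(Ω) → 𝓓'(Ω')`,
  `Ω' ≤ Ω` (transpose of Mathlib's extension-by-zero `TestFunction.monoCLM`), and
  `Literature.Analysis.Distribution.IsHypoellipticOn.isSmoothOn_of_le`: hypoellipticity in `Ω'`
  yields the regularity conclusion on open `U ⊆ Ω'` for distributions on any larger `Ω`.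
* `Literature.Analysis.Distribution.IsHypoellipticOn.of_locally` — **hypoellipticity is a local
  property**: if every point of `Ω` has an open neighbourhood `Ω' ⊆ Ω` in which `P` is
  hypoelliptic, then `P` is hypoelliptic in `Ω`.

The reference measure `μ` is assumed locally finite and positive on nonempty open sets (any
additive Haar measure of a finite-dimensional space).

## References

* L. Hörmander, *Hypoelliptic second order differential equations*, Acta Math. 119 (1967)
  147–171, §3 (Prop. 3.2: "The same is true for open subsets of `Ω`").
* L. Hörmander, *The Analysis of Linear Partial Differential Operators I*, 2nd ed. (1990),
  Thm 2.2.1 / Thm 2.2.4 (localization: a distribution is determined by, and can be glued from,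
  its restrictions to an open cover).
-/

noncomputable section

open MeasureTheory TopologicalSpace Set Function Distributions Filter
open scoped ContDiff Manifold Topology

namespace Literature.Analysis.Distribution

variable {E : Type*} [NormedAddCommGroup E] [NormedSpace ℝ E]

/-! ### Monotonicity of the smoothness predicates in the open set -/

section Mono

variable [MeasurableSpace E] {Ω : Opens E} {μ : Measure E}

/-- `u|_U ∈ C^∞(U)` implies `u|_V ∈ C^∞(V)` for `V ⊆ U`. [folklore] -/
theorem IsSmoothOn.mono {u : 𝓓'(Ω, ℝ)} {U V : Set E} (h : IsSmoothOn u μ U) (hVU : V ⊆ U) :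
    IsSmoothOn u μ V := by
  obtain ⟨g, hg, hgu⟩ := h
  exact ⟨g, hg.mono hVU, fun φ hφ => hgu φ (hφ.trans hVU)⟩

/-- `(Pu)|_U ∈ C^∞(U)` implies `(Pu)|_V ∈ C^∞(V)` for `V ⊆ U`. [folklore] -/
theorem ImageIsSmoothOn.mono {u : 𝓓'(Ω, ℝ)} {tP : (E → ℝ) → E → ℝ} {U V : Set E}
    (h : ImageIsSmoothOn u tP μ U) (hVU : V ⊆ U) : ImageIsSmoothOn u tP μ V := by
  obtain ⟨f, hf, hfu⟩ := h
  exact ⟨f, hf.mono hVU, fun φ ψ hφ hψ => hfu φ ψ (hφ.trans hVU) hψ⟩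

end Mono

/-! ### Restriction of distributions to smaller open sets -/

section Restrict

variable {Ω : Opens E}

/-- The restriction `u|_{Ω'} ∈ 𝓓'(Ω')` of a distribution `u ∈ 𝓓'(Ω)` to an open set `Ω'`
(intended for `Ω' ≤ Ω`): `⟨u|_{Ω'}, φ⟩ = ⟨u, φ~⟩` with `φ~ ∈ 𝓓(Ω)` the extension by zero of
`φ ∈ 𝓓(Ω')` (Mathlib's `TestFunction.monoCLM`, which is the zero map when `¬ Ω' ≤ Ω`; this
junk case is never used). [folklore] -/
def restrictOpens (u : 𝓓'(Ω, ℝ)) (Ω' : Opens E) : 𝓓'(Ω', ℝ) :=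
  (show 𝓓(Ω', ℝ) →L[ℝ] ℝ from
    (show 𝓓(Ω, ℝ) →L[ℝ] ℝ from u).comp (TestFunction.monoCLM ℝ : 𝓓(Ω', ℝ) →L[ℝ] 𝓓(Ω, ℝ)))

/-- `⟨u|_{Ω'}, φ⟩ = ⟨u, φ~⟩`. [folklore] -/
theorem restrictOpens_apply (u : 𝓓'(Ω, ℝ)) (Ω' : Opens E) (φ : 𝓓(Ω', ℝ)) :
    restrictOpens u Ω' φ = u (TestFunction.monoCLM ℝ φ : 𝓓(Ω, ℝ)) := rfl

/-- The extension by zero of `φ ∈ 𝓓(Ω')` to `Ω ⊇ Ω'` is the same function. [folklore] -/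
theorem coe_monoCLM_of_le {Ω' : Opens E} (hle : Ω' ≤ Ω) (φ : 𝓓(Ω', ℝ)) :
    ((TestFunction.monoCLM ℝ φ : 𝓓(Ω, ℝ)) : E → ℝ) = φ := by
  rw [TestFunction.monoCLM_apply]
  simp [hle]

/-- A test function on `Ω` whose topological support lies in the open set `Ω'`, viewed as a
test function on `Ω'`. [folklore] -/
def toOpens (φ : 𝓓(Ω, ℝ)) (Ω' : Opens E) (h : tsupport (φ : E → ℝ) ⊆ Ω') : 𝓓(Ω', ℝ) :=
  ⟨φ, φ.contDiff, φ.hasCompactSupport, h⟩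

/-- `toOpens` does not change the function. [folklore] -/
@[simp] theorem coe_toOpens (φ : 𝓓(Ω, ℝ)) (Ω' : Opens E) (h : tsupport (φ : E → ℝ) ⊆ Ω') :
    (toOpens φ Ω' h : E → ℝ) = φ := rfl

/-- Extending `toOpens φ` back by zero returns `φ`. [folklore] -/
theorem monoCLM_toOpens {Ω' : Opens E} (hle : Ω' ≤ Ω) (φ : 𝓓(Ω, ℝ))
    (h : tsupport (φ : E → ℝ) ⊆ Ω') :
    (TestFunction.monoCLM ℝ (toOpens φ Ω' h) : 𝓓(Ω, ℝ)) = φ := by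
  ext x
  rw [coe_monoCLM_of_le hle, coe_toOpens]

variable [MeasurableSpace E] {μ : Measure E}

/-- **Hypoellipticity in `Ω'` serves distributions on any larger `Ω`.** If `P` is hypoelliptic
in `Ω' ≤ Ω`, `u ∈ 𝓓'(Ω)`, `U ⊆ Ω'` is open and `(Pu)|_U ∈ C^∞(U)`, then `u|_U ∈ C^∞(U)`:
apply the hypothesis to the restriction `u|_{Ω'}`. [folklore] -/
theorem IsHypoellipticOn.isSmoothOn_of_le {Ω' : Opens E} {tP : (E → ℝ) → E → ℝ}
    (h : IsHypoellipticOn Ω' tP μ) (hle : Ω' ≤ Ω) (u : 𝓓'(Ω, ℝ)) {U : Set E} (hU : IsOpen U)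
    (hUΩ' : U ⊆ Ω') (hPu : ImageIsSmoothOn u tP μ U) : IsSmoothOn u μ U := by
  obtain ⟨f, hf, hfu⟩ := hPu
  have h1 : ImageIsSmoothOn (restrictOpens u Ω') tP μ U := by
    refine ⟨f, hf, fun φ ψ hφ hψ => ?_⟩
    rw [restrictOpens_apply]
    have hcφ := coe_monoCLM_of_le hle φ
    have hcψ := coe_monoCLM_of_le hle ψ
    have := hfu (TestFunction.monoCLM ℝ φ) (TestFunction.monoCLM ℝ ψ) (by rw [hcφ]; exact hφ)
      (by rw [hcψ, hcφ]; exact hψ)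
    rw [this]
    simp only [hcφ]
  obtain ⟨g, hg, hgu⟩ := h (restrictOpens u Ω') U hU hUΩ' h1
  refine ⟨g, hg, fun φ hφ => ?_⟩
  have := hgu (toOpens φ Ω' (hφ.trans hUΩ')) (by rw [coe_toOpens]; exact hφ)
  rwa [restrictOpens_apply, monoCLM_toOpens hle] at this

end Restrict

/-! ### Gluing local smooth densities -/

section Glue

variable [FiniteDimensional ℝ E] [MeasurableSpace E] [BorelSpace E] {Ω : Opens E}
  {μ : Measure E} [IsLocallyFiniteMeasure μ] [μ.IsOpenPosMeasure]

omit [NormedSpace ℝ E] [FiniteDimensional ℝ E] [MeasurableSpace E] [BorelSpace E] in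
/-- A function continuous on an open set `V`, multiplied by a continuous function whose
topological support lies in `V`, is continuous everywhere. [folklore] -/
theorem continuous_mul_of_tsupport_subset {g φ : E → ℝ} {V : Set E} (hV : IsOpen V)
    (hg : ContinuousOn g V) (hφ : Continuous φ) (hφV : tsupport φ ⊆ V) :
    Continuous fun x => g x * φ x := by
  rw [continuous_iff_continuousAt]
  intro x
  by_cases hx : x ∈ V
  · exact ((hg x hx).continuousAt (hV.mem_nhds hx)).mul hφ.continuousAt
  · have hx' : x ∉ tsupport φ := fun h' => hx (hφV h')
    have h0 : (fun _ => (0 : ℝ)) =ᶠ[𝓝 x] fun y => g y * φ y := by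
      filter_upwards [(isClosed_tsupport φ).isOpen_compl.mem_nhds hx'] with y hy
      rw [image_eq_zero_of_notMem_tsupport hy, mul_zero]
    exact continuousAt_const.congr h0

omit [μ.IsOpenPosMeasure] in
/-- Such a product with a compactly supported factor is integrable for a locally finite
measure. [folklore] -/
theorem integrable_mul_of_tsupport_subset {g φ : E → ℝ} {V : Set E} (hV : IsOpen V)
    (hg : ContinuousOn g V) (hφ : Continuous φ) (hφc : HasCompactSupport φ)
    (hφV : tsupport φ ⊆ V) : Integrable (fun x => g x * φ x) μ :=
  (continuous_mul_of_tsupport_subset hV hg hφ hφV).integrable_of_hasCompactSupport hφc.mul_left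

/-- **Local densities agree on overlaps.** Two functions, continuous on open sets `V` and `W`,
which integrate every smooth function compactly supported in `V ∩ W` to the same value, agree
on `V ∩ W` (fundamental lemma of the calculus of variations + continuity, the measure being
locally finite and positive on open sets). [folklore] -/
theorem eqOn_of_forall_integral_mul_eq {V W : Set E} (hV : IsOpen V) (hW : IsOpen W)
    {g₁ g₂ : E → ℝ} (hg₁ : ContinuousOn g₁ V) (hg₂ : ContinuousOn g₂ W)
    (h : ∀ φ : E → ℝ, ContDiff ℝ ∞ φ → HasCompactSupport φ → tsupport φ ⊆ V ∩ W →
      ∫ x, g₁ x * φ x ∂μ = ∫ x, g₂ x * φ x ∂μ) :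
    EqOn g₁ g₂ (V ∩ W) := by
  have hS : IsOpen (V ∩ W) := hV.inter hW
  have hc₁ : ContinuousOn g₁ (V ∩ W) := hg₁.mono inter_subset_left
  have hc₂ : ContinuousOn g₂ (V ∩ W) := hg₂.mono inter_subset_right
  have hli : LocallyIntegrableOn (fun x => g₁ x - g₂ x) (V ∩ W) μ :=
    (hc₁.sub hc₂).locallyIntegrableOn hS.measurableSet
  have hae : ∀ᵐ x ∂μ, x ∈ V ∩ W → (fun x => g₁ x - g₂ x) x = 0 := by
    refine hS.ae_eq_zero_of_integral_contDiff_smul_eq_zero hli fun φ hφ hφc hφS => ?_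
    have i₁ : Integrable (fun x => g₁ x * φ x) μ :=
      integrable_mul_of_tsupport_subset hV hg₁ hφ.continuous hφc (hφS.trans inter_subset_left)
    have i₂ : Integrable (fun x => g₂ x * φ x) μ :=
      integrable_mul_of_tsupport_subset hW hg₂ hφ.continuous hφc (hφS.trans inter_subset_right)
    have e : (fun x => φ x • (g₁ x - g₂ x)) = fun x => g₁ x * φ x - g₂ x * φ x := by
      ext x; simp only [smul_eq_mul]; ring
    rw [e, integral_sub i₁ i₂, h φ hφ hφc hφS, sub_self]
  have hae' : g₁ =ᵐ[μ.restrict (V ∩ W)] g₂ := by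
    rw [EventuallyEq, ae_restrict_iff' hS.measurableSet]
    filter_upwards [hae] with x hx hxS
    exact sub_eq_zero.1 (hx hxS)
  exact Measure.eqOn_open_of_ae_eq hae' hS hc₁ hc₂

omit [FiniteDimensional ℝ E] [MeasurableSpace E] [BorelSpace E] in
/-- Evaluation of a finite sum of test functions. [folklore] -/
theorem coe_finset_sum_apply {κ : Type*} (s : Finset κ) (f : κ → 𝓓(Ω, ℝ)) (x : E) :
    (∑ i ∈ s, f i) x = ∑ i ∈ s, f i x := by
  classical
  induction s using Finset.induction_on with
  | empty => simp
  | insert i s his ih => rw [Finset.sum_insert his, Finset.sum_insert his, add_apply, ih]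

/-- **Being a `C^∞` function is a local property of a distribution** (sheaf property of
`C^∞ ∩ 𝓓'`): if every point of `U ⊆ Ω` has an open neighbourhood `V ⊆ U` on which the
distribution `u` is a smooth function, then `u` is a smooth function on `U`. The local
densities agree on overlaps (`eqOn_of_forall_integral_mul_eq`) and glue to a function smooth on
`U`; a test function supported in `U` is split by a smooth partition of unity on its support,
subordinate to the cover, into finitely many test functions each supported in one piece.
[folklore] -/
theorem IsSmoothOn.of_locally {u : 𝓓'(Ω, ℝ)} {U : Set E} (hUΩ : U ⊆ (Ω : Set E))
    (h : ∀ x ∈ U, ∃ V : Set E, IsOpen V ∧ x ∈ V ∧ V ⊆ U ∧ IsSmoothOn u μ V) :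
    IsSmoothOn u μ U := by
  classical
  -- the admissible pieces, their densities, and compatibility on overlaps
  let ι := {V : Set E // IsOpen V ∧ V ⊆ U ∧ IsSmoothOn u μ V}
  have hex : ∀ i : ι, ∃ g : E → ℝ, ContDiffOn ℝ ∞ g i.1 ∧
      ∀ φ : 𝓓(Ω, ℝ), tsupport (φ : E → ℝ) ⊆ i.1 → u φ = ∫ x, g x * φ x ∂μ := fun i => i.2.2.2
  choose g hgs hgu using hex
  have hcompat : ∀ i j : ι, EqOn (g i) (g j) (i.1 ∩ j.1) := by
    intro i j
    refine eqOn_of_forall_integral_mul_eq (μ := μ) i.2.1 j.2.1 (hgs i).continuousOn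
      (hgs j).continuousOn fun φ hφ hφc hφS => ?_
    let ψ : 𝓓(Ω, ℝ) :=
      ⟨φ, hφ, hφc, (hφS.trans inter_subset_left).trans (i.2.2.1.trans hUΩ)⟩
    have e₁ := hgu i ψ (hφS.trans inter_subset_left)
    have e₂ := hgu j ψ (hφS.trans inter_subset_right)
    exact e₁.symm.trans e₂
  have hcov : ∀ x ∈ U, ∃ i : ι, x ∈ i.1 := fun x hx => by
    obtain ⟨V, hV, hxV, hVU, hs⟩ := h x hx
    exact ⟨⟨V, hV, hVU, hs⟩, hxV⟩
  -- the glued density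
  let G : E → ℝ := fun z => if hz : ∃ i : ι, z ∈ i.1 then g hz.choose z else 0
  have hG : ∀ i : ι, EqOn G (g i) i.1 := by
    intro i z hz
    have hz' : ∃ i : ι, z ∈ i.1 := ⟨i, hz⟩
    simp only [G, dif_pos hz']
    exact hcompat hz'.choose i ⟨hz'.choose_spec, hz⟩
  refine ⟨G, ?_, fun φ hφ => ?_⟩
  · -- smoothness on `U` is local
    refine contDiffOn_of_locally_contDiffOn fun x hx => ?_
    obtain ⟨i, hxi⟩ := hcov x hx
    exact ⟨i.1, i.2.1, hxi, ((hgs i).congr (hG i)).mono inter_subset_right⟩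
  · -- the identity `⟨u, φ⟩ = ∫ G φ` for `φ` supported in `U`
    set K : Set E := tsupport (φ : E → ℝ) with hK
    have hKc : IsCompact K := φ.hasCompactSupport
    have hKcov : K ⊆ ⋃ i : ι, i.1 := fun x hx => mem_iUnion.2 (hcov x (hφ hx))
    obtain ⟨ρ, hρ⟩ := SmoothPartitionOfUnity.exists_isSubordinate 𝓘(ℝ, E) hKc.isClosed
      (fun i : ι => i.1) (fun i => i.2.1) hKcov
    have hρs : ∀ i, ContDiff ℝ ∞ (ρ i : E → ℝ) := fun i =>
      contMDiff_iff_contDiff.1 (ρ i).contMDiff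
    -- finitely many members of the partition meet `K`
    have hfin : {i | (support (ρ i : E → ℝ) ∩ K).Nonempty}.Finite :=
      ρ.locallyFinite.finite_nonempty_inter_compact hKc
    set T : Finset ι := hfin.toFinset with hT
    -- the pieces `ρ_i φ` as test functions supported in single pieces of the cover
    let piece : ι → 𝓓(Ω, ℝ) := fun i =>
      ⟨fun x => ρ i x * φ x, (hρs i).mul φ.contDiff, φ.hasCompactSupport.mul_left,
        (tsupport_mul_subset_right (f := fun x => ρ i x) (g := (φ : E → ℝ))).trans
          φ.tsupport_subset⟩
    have hpiece : ∀ i x, piece i x = ρ i x * φ x := fun i x => rfl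
    have hpsupp : ∀ i, tsupport (piece i : E → ℝ) ⊆ i.1 := fun i =>
      (tsupport_mul_subset_left (f := fun x => ρ i x) (g := (φ : E → ℝ))).trans (hρ i)
    -- `φ = ∑_{i ∈ T} ρ_i φ`
    have hsum : φ = ∑ i ∈ T, piece i := by
      ext x
      rw [coe_finset_sum_apply]
      simp only [hpiece, ← Finset.sum_mul]
      by_cases hx : x ∈ K
      · have hsub : (support fun i => ρ i x) ⊆ (T : Set ι) := by
          intro i hi
          rw [hT, Finite.coe_toFinset]
          exact ⟨x, hi, hx⟩
        rw [← finsum_eq_sum_of_support_subset _ hsub, ρ.sum_eq_one hx, one_mul]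
      · rw [image_eq_zero_of_notMem_tsupport hx, mul_zero]
    -- evaluate `u` piece by piece
    have hterm : ∀ i ∈ T, u (piece i) = ∫ x, G x * piece i x ∂μ := by
      intro i _
      rw [hgu i (piece i) (hpsupp i)]
      refine integral_congr_ae (Eventually.of_forall fun x => ?_)
      by_cases hx : x ∈ i.1
      · simp only [hG i hx]
      · have : piece i x = 0 := image_eq_zero_of_notMem_tsupport fun h' => hx (hpsupp i h')
        simp only [this, mul_zero]
    have hint : ∀ i ∈ T, Integrable (fun x => G x * piece i x) μ := by
      intro i _
      have e : (fun x => G x * piece i x) = fun x => g i x * piece i x := by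
        ext x
        by_cases hx : x ∈ i.1
        · rw [hG i hx]
        · have : piece i x = 0 := image_eq_zero_of_notMem_tsupport fun h' => hx (hpsupp i h')
          rw [this, mul_zero, mul_zero]
      rw [e]
      exact integrable_mul_of_tsupport_subset i.2.1 (hgs i).continuousOn (piece i).continuous
        (piece i).hasCompactSupport (hpsupp i)
    rw [hsum, map_sum, Finset.sum_congr rfl hterm, ← integral_finsetSum _ hint]
    refine integral_congr_ae (Eventually.of_forall fun x => ?_)
    simp only [coe_finset_sum_apply, Finset.mul_sum]

end Glue

/-! ### Hypoellipticity is a local property -/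

section Local

variable [FiniteDimensional ℝ E] [MeasurableSpace E] [BorelSpace E] {Ω : Opens E}
  {μ : Measure E} [IsLocallyFiniteMeasure μ] [μ.IsOpenPosMeasure]

/-- **Hypoellipticity is a local property** (used implicitly in Hörmander 1967, §3: Theorem 4.3
is applied where finitely many brackets span, and Prop. 3.2 "is true for open subsets of `Ω`,
so in particular `P` is hypoelliptic"): if every point of `Ω` has an open neighbourhood
`Ω' ≤ Ω` in which `P` is hypoelliptic, then `P` is hypoelliptic in `Ω`. [folklore] -/
theorem IsHypoellipticOn.of_locally {tP : (E → ℝ) → E → ℝ}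
    (h : ∀ x ∈ (Ω : Set E), ∃ Ω' : Opens E, x ∈ Ω' ∧ Ω' ≤ Ω ∧ IsHypoellipticOn Ω' tP μ) :
    IsHypoellipticOn Ω tP μ := by
  intro u U hU hUΩ hPu
  refine IsSmoothOn.of_locally hUΩ fun x hx => ?_
  obtain ⟨Ω', hxΩ', hle, hΩ'⟩ := h x (hUΩ hx)
  refine ⟨U ∩ Ω', hU.inter Ω'.isOpen, ⟨hx, hxΩ'⟩, inter_subset_left, ?_⟩
  exact hΩ'.isSmoothOn_of_le hle u (hU.inter Ω'.isOpen) inter_subset_right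
    (hPu.mono inter_subset_left)

end Local

end Literature.Analysis.Distribution
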